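import Mathlib
import HarnessLib
import Summits.NavierStokesRegularity.NavierStokesRegularity.Theorems.PoloidalWindowDoorPoloidalWindowRigidityUntwistedStuartTranslation2
import Summits.NavierStokesRegularity.NavierStokesRegularity.Theorems.PoloidalWindowDoorPoloidalWindowRigidityUntwistedStuartTranslationAnalytic

/-!
# Route `PoloidalWindowDoor`, crux `PoloidalWindowRigidity` (K2, stmt-NavierStokesRegularity-19708), skeleton `lrc-jet` v5,
# stub `stub_untwisted` — brick F4-tr-d (part 3): THE BRANCH-2b REGION OF AN UNTWISTED GERM IS EMPTY

Cell ns-regularity-ideate, K2 lead ns-poloidal-K2-p1 (gen 6; `--supports stmt-NavierStokesRegularity-19708`, helper; BRIEF-v5-bricks-v2 (S4); UNTWISTED-NOTE §3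
(2b)).  Conclusion of the translation: on an open set `U` of one slice let `w` be untwisted (`∂₂w = P(w,y₂)`) with slope structure function `Λ(w,y₂)`
(`w` analytic, `P, Λ` analytic at the leaf points), non-degenerate (`∂_b w ≠ 0`, `Λ ∉ {0,1}`), and suppose the three pointwise relations of Branch 2b hold
on `U`: `D₁ = 0` (brick F3a), `D₃ = 0` (brick F3b) and the consistency relation `Λ·ċ = (Ld + ΛPw)·c` of the divergence identity (`c = DP(P,1) = ∂₂²w`).
Then `U` is empty — `branch2b_false`.  Proof: along the vertical coordinate plane through a point of `U` (parts 1–2) the fields `Qu = Λ∂_b w` and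
`H = (1−Λ)∂_b w` satisfy the hypotheses (α), (β) of `…UntwistedStuartBranch.stuartBranch_false` with `Qu = d(z)θ(t)`, `Θ(t) = ξ(p(t,z₀)) − ξ(p(0,z₀))`,
`ε(z) = ξ(p(0,z))`, `M₁(t) = −∂_t c(p(t,z₀))`; the derivative data of `d, ε` come from analyticity.

WHAT THIS IS NOT: not a claim about Navier–Stokes — calculus bookkeeping (bears_on LADDER-NS N0 via crux K2 = stmt-19708).  The assembly of
`stub_untwisted` feeds this with the structure functions of a class profile (brick F2) on the region where both Wronskians vanish identically.
-/

noncomputable section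

-- the summit and its single sub-problem share the name (CONVENTIONS §1), as in every Theorems file
set_option linter.dupNamespace false

namespace Summit.NavierStokesRegularity.NavierStokesRegularity.Theorems.PoloidalWindowDoorPoloidalWindowRigidityUntwistedStuartTranslation3

open Set Function Filter Topology Metric
open Summit.NavierStokesRegularity.NavierStokesRegularity.Theorems.PoloidalWindowDoorPoloidalWindowRigidityConstantShearMeans
open Summit.NavierStokesRegularity.NavierStokesRegularity.Theorems.PoloidalWindowDoorLrcModEntireLeafwiseVertical
open Summit.NavierStokesRegularity.NavierStokesRegularity.Theorems.PoloidalWindowDoorPoloidalWindowRigidityUntwistedSeparation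
open Summit.NavierStokesRegularity.NavierStokesRegularity.Theorems.PoloidalWindowDoorPoloidalWindowRigidityUntwistedBracket
open Summit.NavierStokesRegularity.NavierStokesRegularity.Theorems.PoloidalWindowDoorPoloidalWindowRigidityUntwistedLogDerivatives
open Summit.NavierStokesRegularity.NavierStokesRegularity.Theorems.PoloidalWindowDoorPoloidalWindowRigidityUntwistedStuartBranch
open Summit.NavierStokesRegularity.NavierStokesRegularity.Theorems.PoloidalWindowDoorPoloidalWindowRigidityUntwistedStuartTranslation
open Summit.NavierStokesRegularity.NavierStokesRegularity.Theorems.PoloidalWindowDoorPoloidalWindowRigidityUntwistedStuartTranslation2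
open Summit.NavierStokesRegularity.NavierStokesRegularity.Theorems.PoloidalWindowDoorPoloidalWindowRigidityUntwistedStuartTranslationAnalytic

/-! ### The Branch-2b region is empty -/

section Main

variable {w : EuclideanSpace ℝ (Fin 3) → ℝ} {P Λ : ℝ × ℝ → ℝ} {U : Set (EuclideanSpace ℝ (Fin 3))}
  {y₀ : EuclideanSpace ℝ (Fin 3)} {b : Fin 3}

/-- **THE BRANCH-2b REGION OF AN UNTWISTED NON-DEGENERATE GERM IS EMPTY.**  See the module docstring; `D₁`, `D₃` are the Wronskians of bricks F3a/F3b
(written out), the third relation is the consistency identity `Λ·ċ = (Ld + ΛPw)·c` with `c = DP(·)(P,1)`, `ċ = Dc(·)(P,1)`. [folklore] -/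
theorem branch2b_false (hU : IsOpen U) (hy₀ : y₀ ∈ U) (hb : b ≠ 2)
    (hwA : AnalyticOnNhd ℝ w univ)
    (hPA : ∀ y ∈ U, AnalyticAt ℝ P (w y, y 2)) (hΛA : ∀ y ∈ U, AnalyticAt ℝ Λ (w y, y 2))
    (hP : ∀ y ∈ U, fderiv ℝ w y (EuclideanSpace.single 2 (1 : ℝ)) = P (w y, y 2))
    (hbne : ∀ y ∈ U, fderiv ℝ w y (EuclideanSpace.single b (1 : ℝ)) ≠ 0)
    (hL0 : ∀ y ∈ U, Λ (w y, y 2) ≠ 0) (hL1 : ∀ y ∈ U, Λ (w y, y 2) ≠ 1)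
    (hD1 : ∀ y ∈ U,
      Λ (w y, y 2) * (Λ (w y, y 2) * fderiv ℝ (fun q => fderiv ℝ P q ((1 : ℝ), (0 : ℝ))) (w y, y 2) (1, 0) +
            fderiv ℝ (fun q => fderiv ℝ Λ q ((1 : ℝ), (0 : ℝ))) (w y, y 2) (P (w y, y 2), 1) +
            2 * fderiv ℝ Λ (w y, y 2) (1, 0) * fderiv ℝ P (w y, y 2) (1, 0)) -
          fderiv ℝ Λ (w y, y 2) (1, 0) * (fderiv ℝ Λ (w y, y 2) (P (w y, y 2), 1) + Λ (w y, y 2) * fderiv ℝ P (w y, y 2) (1, 0)) = 0)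
    (hD2 : ∀ y ∈ U,
      Λ (w y, y 2) * fderiv ℝ (fun q => fderiv ℝ P q (P q, 1)) (w y, y 2) (P (w y, y 2), 1) =
        (fderiv ℝ Λ (w y, y 2) (P (w y, y 2), 1) + Λ (w y, y 2) * fderiv ℝ P (w y, y 2) (1, 0)) *
          fderiv ℝ P (w y, y 2) (P (w y, y 2), 1))
    (hD3 : ∀ y ∈ U,
      (Λ (w y, y 2) * (1 - Λ (w y, y 2))) *
            (Λ (w y, y 2) * (1 - Λ (w y, y 2)) * Λ (w y, y 2) +
              fderiv ℝ (fun q => fderiv ℝ Λ q ((1 : ℝ), (0 : ℝ))) (w y, y 2) (P (w y, y 2), 1) +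
              2 * fderiv ℝ Λ (w y, y 2) (1, 0) * fderiv ℝ P (w y, y 2) (1, 0)) -
          fderiv ℝ Λ (w y, y 2) (1, 0) *
            ((1 - 2 * Λ (w y, y 2)) * fderiv ℝ Λ (w y, y 2) (P (w y, y 2), 1) +
              Λ (w y, y 2) * (1 - Λ (w y, y 2)) * fderiv ℝ P (w y, y 2) (1, 0)) = 0) : False := by
  have hw : ContDiff ℝ 2 w := hwA.contDiff
  have hwd : Differentiable ℝ w := hw.differentiable (by norm_num)
  have hP2 : ∀ y ∈ U, ContDiffAt ℝ 2 P (w y, y 2) := fun y hy => (hPA y hy).contDiffAt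
  have hΛ2 : ∀ y ∈ U, ContDiffAt ℝ 2 Λ (w y, y 2) := fun y hy => (hΛA y hy).contDiffAt
  have hPd : ∀ y ∈ U, DifferentiableAt ℝ P (w y, y 2) := fun y hy => (hP2 y hy).differentiableAt (by norm_num)
  have hΛd : ∀ y ∈ U, DifferentiableAt ℝ Λ (w y, y 2) := fun y hy => (hΛ2 y hy).differentiableAt (by norm_num)
  obtain ⟨ρ, hρ, hpatch⟩ := exists_plane_patch hU hy₀ b
  set Y : ℝ → ℝ → EuclideanSpace ℝ (Fin 3) := fun t z =>
    y₀ + t • EuclideanSpace.single b (1 : ℝ) + (z - y₀ 2) • EuclideanSpace.single (2 : Fin 3) (1 : ℝ) with hY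
  have hY2 : ∀ t z, (Y t z) 2 = z := fun t z => plane_apply_two y₀ hb t z
  have hmemI : ∀ {t}, t ∈ Ioo (-ρ) ρ → ∀ {z}, z ∈ Ioo ((y₀ 2) - ρ) ((y₀ 2) + ρ) → Y t z ∈ U := by
    intro t ht z hz
    exact hpatch t z (abs_lt.mpr ⟨ht.1, ht.2⟩) (abs_lt.mpr ⟨by linarith [hz.1], by linarith [hz.2]⟩)
  have h0I : (0 : ℝ) ∈ Ioo (-ρ) ρ := ⟨by linarith, hρ⟩
  have hz0J : (y₀ 2) ∈ Ioo ((y₀ 2) - ρ) ((y₀ 2) + ρ) := ⟨by linarith, by linarith⟩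
  have hsegI : ∀ {t}, t ∈ Ioo (-ρ) ρ → ∀ t' ∈ uIcc (0 : ℝ) t, t' ∈ Ioo (-ρ) ρ := by
    intro t ht t' ht'
    rcases le_total 0 t with h | h
    · rw [uIcc_of_le h] at ht'; exact ⟨by linarith [ht'.1], lt_of_le_of_lt ht'.2 ht.2⟩
    · rw [uIcc_of_ge h] at ht'; exact ⟨lt_of_lt_of_le ht.1 ht'.1, by linarith [ht'.2]⟩
  have hsegJ : ∀ {z}, z ∈ Ioo ((y₀ 2) - ρ) ((y₀ 2) + ρ) → ∀ ζ ∈ uIcc (y₀ 2) z, ζ ∈ Ioo ((y₀ 2) - ρ) ((y₀ 2) + ρ) := by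
    intro z hz ζ hζ
    rcases le_total (y₀ 2) z with h | h
    · rw [uIcc_of_le h] at hζ; exact ⟨by linarith [hζ.1], lt_of_le_of_lt hζ.2 hz.2⟩
    · rw [uIcc_of_ge h] at hζ; exact ⟨lt_of_lt_of_le hz.1 hζ.1, by linarith [hζ.2]⟩
  set wb : ℝ → ℝ → ℝ := fun t z => fderiv ℝ w (Y t z) (EuclideanSpace.single b (1 : ℝ)) with hwb
  set L : ℝ → ℝ → ℝ := fun t z => Λ (w (Y t z), z) with hLdef
  set Qu : ℝ → ℝ → ℝ := fun t z => L t z * wb t z with hQu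
  set Hf : ℝ → ℝ → ℝ := fun t z => (1 - L t z) * wb t z with hHf
  set ηF : ℝ × ℝ → ℝ := fun q => fderiv ℝ P q ((1 : ℝ), (0 : ℝ)) + fderiv ℝ Λ q (P q, 1) / Λ q with hηF
  set ξF : ℝ × ℝ → ℝ := fun q => fderiv ℝ P q ((1 : ℝ), (0 : ℝ)) - fderiv ℝ Λ q (P q, 1) / (1 - Λ q) with hξF
  set cF : ℝ × ℝ → ℝ := fun q => fderiv ℝ P q (P q, 1) with hcF
  set Pwf : ℝ × ℝ → ℝ := fun q => fderiv ℝ P q ((1 : ℝ), (0 : ℝ)) with hPwf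
  have hL0' : ∀ {t}, t ∈ Ioo (-ρ) ρ → ∀ {z}, z ∈ Ioo ((y₀ 2) - ρ) ((y₀ 2) + ρ) → L t z ≠ 0 := by
    intro t ht z hz; have h := hL0 _ (hmemI ht hz); rw [hY2] at h; exact h
  have hL1' : ∀ {t}, t ∈ Ioo (-ρ) ρ → ∀ {z}, z ∈ Ioo ((y₀ 2) - ρ) ((y₀ 2) + ρ) → L t z ≠ 1 := by
    intro t ht z hz; have h := hL1 _ (hmemI ht hz); rw [hY2] at h; exact h
  have hwb0 : ∀ {t}, t ∈ Ioo (-ρ) ρ → ∀ {z}, z ∈ Ioo ((y₀ 2) - ρ) ((y₀ 2) + ρ) → wb t z ≠ 0 :=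
    fun ht _ hz => hbne _ (hmemI ht hz)
  have hQu0 : ∀ {t}, t ∈ Ioo (-ρ) ρ → ∀ {z}, z ∈ Ioo ((y₀ 2) - ρ) ((y₀ 2) + ρ) → Qu t z ≠ 0 :=
    fun ht _ hz => mul_ne_zero (hL0' ht hz) (hwb0 ht hz)
  have hHf0 : ∀ {t}, t ∈ Ioo (-ρ) ρ → ∀ {z}, z ∈ Ioo ((y₀ 2) - ρ) ((y₀ 2) + ρ) → Hf t z ≠ 0 :=
    fun ht _ hz => mul_ne_zero (sub_ne_zero.mpr (Ne.symm (hL1' ht hz))) (hwb0 ht hz)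
  -- analyticity / differentiability of the structure quantities at plane points
  have hstruct : ∀ {t}, t ∈ Ioo (-ρ) ρ → ∀ {z}, z ∈ Ioo ((y₀ 2) - ρ) ((y₀ 2) + ρ) →
      AnalyticAt ℝ ηF (w (Y t z), z) ∧ AnalyticAt ℝ ξF (w (Y t z), z) ∧ AnalyticAt ℝ cF (w (Y t z), z) ∧ AnalyticAt ℝ Pwf (w (Y t z), z) := by
    intro t ht z hz
    have hm := hmemI ht hz
    have h := analyticAt_structure (hPA _ hm) (hΛA _ hm) (hL0 _ hm) (hL1 _ hm)
    rw [hY2] at h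
    exact h
  -- (1) vertical derivatives of `Qu` and `Hf`
  have hQuz : ∀ {t}, t ∈ Ioo (-ρ) ρ → ∀ {z}, z ∈ Ioo ((y₀ 2) - ρ) ((y₀ 2) + ρ) → HasDerivAt (Qu t) (ηF (w (Y t z), z) * Qu t z) z := by
    intro t ht z hz
    have h := hasDerivAt_Qu_z (y₀ := y₀) (t := t) (z := z) hU hw hb hPd hΛd hP (hmemI ht hz)
    refine h.congr_deriv ?_
    have h0 : Λ (w (Y t z), z) ≠ 0 := hL0' ht hz
    simp only [hY] at h0
    simp only [hQu, hLdef, hwb, hηF, hY]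
    field_simp
    ring
  have hHfz : ∀ {t}, t ∈ Ioo (-ρ) ρ → ∀ {z}, z ∈ Ioo ((y₀ 2) - ρ) ((y₀ 2) + ρ) → HasDerivAt (Hf t) (ξF (w (Y t z), z) * Hf t z) z := by
    intro t ht z hz
    have h := hasDerivAt_H_z (y₀ := y₀) (t := t) (z := z) hU hw hb hPd hΛd hP (hmemI ht hz)
    refine h.congr_deriv ?_
    have h1 : (1 : ℝ) - L t z ≠ 0 := sub_ne_zero.mpr (Ne.symm (hL1' ht hz))
    simp only [hLdef, hY] at h1
    simp only [hHf, hLdef, hwb, hξF, hY]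
    field_simp
    ring
  -- (2) `η` is constant in `t`
  have hηc : ∀ {t}, t ∈ Ioo (-ρ) ρ → ∀ {z}, z ∈ Ioo ((y₀ 2) - ρ) ((y₀ 2) + ρ) → ηF (w (Y t z), z) = ηF (w (Y 0 z), z) := by
    intro t ht z hz
    have h := eta_const (t := t) (z := z) hw b y₀
      (fun t' ht' => by have := hP2 _ (hmemI (hsegI ht t' ht') hz); rwa [hY2] at this)
      (fun t' ht' => by have := hΛ2 _ (hmemI (hsegI ht t' ht') hz); rwa [hY2] at this)
      (fun t' ht' => by have := hL0 _ (hmemI (hsegI ht t' ht') hz); rwa [hY2] at this)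
      (fun t' ht' => by have := hD1 _ (hmemI (hsegI ht t' ht') hz); simp only [hY2] at this; exact this)
    simpa [hηF, hY] using h
  -- (3) separation of `Qu`
  have hη0cont : ∀ {z}, z ∈ Ioo ((y₀ 2) - ρ) ((y₀ 2) + ρ) → ContinuousOn (fun ζ => ηF (w (Y 0 ζ), ζ)) (uIcc (y₀ 2) z) := by
    intro z hz ζ hζ
    have hζJ := hsegJ hz ζ hζ
    have han := analyticAt_leaf_vline hwA (G := ηF) (y₀ + (0 : ℝ) • (EuclideanSpace.single b (1 : ℝ))) (z := ζ)
      (by rw [foot_apply_two y₀ hb]; exact (hstruct h0I hζJ).1)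
    have e : (fun z' : ℝ => ηF (w (y₀ + (0 : ℝ) • (EuclideanSpace.single b (1 : ℝ)) + (z' - (y₀ + (0 : ℝ) • (EuclideanSpace.single b (1 : ℝ))) 2) • EuclideanSpace.single (2 : Fin 3) (1 : ℝ)), z')) =
        fun ζ => ηF (w (Y 0 ζ), ζ) := by
      funext z'; simp only [hY, foot_apply_two y₀ hb]
    rw [e] at han
    exact han.continuousAt.continuousWithinAt
  have hsep : ∀ {t}, t ∈ Ioo (-ρ) ρ → ∀ {z}, z ∈ Ioo ((y₀ 2) - ρ) ((y₀ 2) + ρ) → Qu t z * Qu 0 (y₀ 2) = Qu t (y₀ 2) * Qu 0 z := by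
    intro t ht z hz
    have h := separation_of_eta_transport (F := Qu) (ηt := fun ζ => ηF (w (Y t ζ), ζ)) (η₀ := fun ζ => ηF (w (Y 0 ζ), ζ))
      (t := t) (z := z) y₀
      (fun ζ hζ => hQuz ht (hsegJ hz ζ hζ)) (fun ζ hζ => hQuz h0I (hsegJ hz ζ hζ))
      (fun ζ hζ => hηc ht (hsegJ hz ζ hζ)) (hη0cont hz)
    simpa using h
  set d : ℝ → ℝ := fun z => Qu 0 z / Qu 0 (y₀ 2) with hd
  set θ : ℝ → ℝ := fun t => Qu t (y₀ 2) with hθ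
  have hd1 : d (y₀ 2) = 1 := by simp only [hd]; exact div_self (hQu0 h0I hz0J)
  have hQudθ : ∀ {t}, t ∈ Ioo (-ρ) ρ → ∀ {z}, z ∈ Ioo ((y₀ 2) - ρ) ((y₀ 2) + ρ) → Qu t z = d z * θ t := by
    intro t ht z hz
    have h := hsep ht hz
    simp only [hd, hθ]
    field_simp [hQu0 h0I hz0J]
    linarith [h]
  have hd0 : ∀ {z}, z ∈ Ioo ((y₀ 2) - ρ) ((y₀ 2) + ρ) → d z ≠ 0 := fun hz => div_ne_zero (hQu0 h0I hz) (hQu0 h0I hz0J)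
  have hθ0 : ∀ {t}, t ∈ Ioo (-ρ) ρ → θ t ≠ 0 := fun ht => hQu0 ht hz0J
  -- (4) horizontal derivative of `ξ`: `∂_t ξ(p(t,z)) = Qu(t,z)`
  have hξt : ∀ {t}, t ∈ Ioo (-ρ) ρ → ∀ {z}, z ∈ Ioo ((y₀ 2) - ρ) ((y₀ 2) + ρ) →
      HasDerivAt (fun t' => ξF (w (Y t' z), z)) (Qu t z) t := by
    intro t ht z hz
    have hm := hmemI ht hz
    have hPc := hP2 _ hm; have hΛc := hΛ2 _ hm; have h0 := hL0 _ hm; have h1 := hL1 _ hm; have hd3 := hD3 _ hm; have hd1' := hD1 _ hm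
    rw [hY2] at hPc hΛc h0 h1 hd3 hd1'
    have hinner := hasDerivAt_w_t hw b y₀ t z
    have houter := hasDerivAt_xi hPc hΛc h0 h1
    have hcomp := houter.comp t hinner
    have e : (fun t' : ℝ => ξF (w (Y t' z), z)) =
        (fun w' : ℝ => fderiv ℝ P (w', z) ((1 : ℝ), (0 : ℝ)) - fderiv ℝ Λ (w', z) (P (w', z), 1) / (1 - Λ (w', z))) ∘
          fun t' : ℝ => w (y₀ + t' • EuclideanSpace.single b (1 : ℝ) + (z - y₀ 2) • EuclideanSpace.single (2 : Fin 3) (1 : ℝ)) := by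
      funext t'; simp only [hξF, hY, Function.comp]
    rw [e]
    refine hcomp.congr_deriv ?_
    rw [hd1', hd3, zero_div, zero_div, add_zero, sub_zero]
  set Θ : ℝ → ℝ := fun t => ξF (w (Y t (y₀ 2)), (y₀ 2)) - ξF (w (Y 0 (y₀ 2)), (y₀ 2)) with hΘ
  set ε : ℝ → ℝ := fun z => ξF (w (Y 0 z), z) with hε
  have hΘ' : ∀ {t}, t ∈ Ioo (-ρ) ρ → HasDerivAt Θ (θ t) t := by
    intro t ht
    have h := (hξt ht hz0J).sub_const (ξF (w (Y 0 (y₀ 2)), (y₀ 2)))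
    exact h
  have hΘ0 : Θ 0 = 0 := by simp only [hΘ, sub_self]
  -- (5) `ξ(p(t,z)) = d z Θ t + ε z`
  have hξaff : ∀ {t}, t ∈ Ioo (-ρ) ρ → ∀ {z}, z ∈ Ioo ((y₀ 2) - ρ) ((y₀ 2) + ρ) → ξF (w (Y t z), z) = d z * Θ t + ε z := by
    intro t ht z hz
    have h := eq_of_hasDerivAt_zero (f := fun t' => ξF (w (Y t' z), z) - d z * Θ t') (a := 0) (c := t) (fun t' ht' => by
      have ht'I := hsegI ht t' ht'
      have h1 := (hξt ht'I hz).sub ((hΘ' ht'I).const_mul (d z))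
      refine h1.congr_deriv ?_
      rw [hQudθ ht'I hz]; ring)
    simp only [hΘ0, mul_zero, sub_zero] at h
    simp only [hε]
    linarith [h]
  set Hz : ℝ → ℝ → ℝ := fun t z => ξF (w (Y t z), z) * Hf t z with hHz
  -- (6) separation of `c` and its `t`-derivative
  have hcz : ∀ {t}, t ∈ Ioo (-ρ) ρ → ∀ {z}, z ∈ Ioo ((y₀ 2) - ρ) ((y₀ 2) + ρ) →
      HasDerivAt (fun z' => cF (w (Y t z'), z')) (ηF (w (Y 0 z), z) * cF (w (Y t z), z)) z := by
    intro t ht z hz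
    have hm := hmemI ht hz
    have hcd : DifferentiableAt ℝ cF (w (Y t z), z) := (hstruct ht hz).2.2.1.differentiableAt
    have h := hasDerivAt_leaf_plane_vert (y₀ := y₀) (G := cF) (t := t) (z := z) hw hb hP hm (by simpa [hY2] using hcd)
    refine h.congr_deriv ?_
    -- `ċ = η·c` from the consistency relation, then `η(p(t,z)) = η(p(0,z))`
    have h2 := hD2 _ hm; have h0 := hL0 _ hm
    rw [hY2] at h2 h0
    rw [← hηc ht hz]
    simp only [hcF, hηF, hY] at h2 h0 ⊢
    have key : fderiv ℝ (fun q : ℝ × ℝ => fderiv ℝ P q (P q, 1))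
          (w (y₀ + t • EuclideanSpace.single b (1 : ℝ) + (z - y₀ 2) • EuclideanSpace.single (2 : Fin 3) (1 : ℝ)), z)
          (P (w (y₀ + t • EuclideanSpace.single b (1 : ℝ) + (z - y₀ 2) • EuclideanSpace.single (2 : Fin 3) (1 : ℝ)), z), 1) =
        (fderiv ℝ Λ (w (y₀ + t • EuclideanSpace.single b (1 : ℝ) + (z - y₀ 2) • EuclideanSpace.single (2 : Fin 3) (1 : ℝ)), z)
              (P (w (y₀ + t • EuclideanSpace.single b (1 : ℝ) + (z - y₀ 2) • EuclideanSpace.single (2 : Fin 3) (1 : ℝ)), z), 1) +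
            Λ (w (y₀ + t • EuclideanSpace.single b (1 : ℝ) + (z - y₀ 2) • EuclideanSpace.single (2 : Fin 3) (1 : ℝ)), z) *
              fderiv ℝ P (w (y₀ + t • EuclideanSpace.single b (1 : ℝ) + (z - y₀ 2) • EuclideanSpace.single (2 : Fin 3) (1 : ℝ)), z) (1, 0)) *
          fderiv ℝ P (w (y₀ + t • EuclideanSpace.single b (1 : ℝ) + (z - y₀ 2) • EuclideanSpace.single (2 : Fin 3) (1 : ℝ)), z)
            (P (w (y₀ + t • EuclideanSpace.single b (1 : ℝ) + (z - y₀ 2) • EuclideanSpace.single (2 : Fin 3) (1 : ℝ)), z), 1) /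
          Λ (w (y₀ + t • EuclideanSpace.single b (1 : ℝ) + (z - y₀ 2) • EuclideanSpace.single (2 : Fin 3) (1 : ℝ)), z) := by
      rw [eq_div_iff h0]
      linear_combination h2
    rw [key]
    field_simp
    ring
  have hdderiv : ∀ {z}, z ∈ Ioo ((y₀ 2) - ρ) ((y₀ 2) + ρ) → HasDerivAt d (ηF (w (Y 0 z), z) * d z) z := by
    intro z hz
    have h := (hQuz h0I hz).div_const (Qu 0 (y₀ 2))
    refine h.congr_deriv ?_
    simp only [hd]; ring
  have hcsep : ∀ {t}, t ∈ Ioo (-ρ) ρ → ∀ {z}, z ∈ Ioo ((y₀ 2) - ρ) ((y₀ 2) + ρ) → cF (w (Y t z), z) = d z * cF (w (Y t (y₀ 2)), (y₀ 2)) := by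
    intro t ht z hz
    have h := proportional_of_transport (f := fun z' => cF (w (Y t z'), z')) (g := d) (a := fun ζ => ηF (w (Y 0 ζ), ζ))
      (z₀ := y₀ 2) (z := z) (hη0cont hz) (fun ζ hζ => ⟨hcz ht (hsegJ hz ζ hζ), hdderiv (hsegJ hz ζ hζ)⟩)
    rw [hd1, mul_one] at h
    linarith [h]
  -- `t`-derivative of `c(p(t,z))`
  have hct : ∀ {t}, t ∈ Ioo (-ρ) ρ → ∀ {z}, z ∈ Ioo ((y₀ 2) - ρ) ((y₀ 2) + ρ) →
      HasDerivAt (fun t' => cF (w (Y t' z), z)) (wb t z * fderiv ℝ cF (w (Y t z), z) (1, 0)) t := by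
    intro t ht z hz
    have hcd : DifferentiableAt ℝ cF (w (Y t z), z) := (hstruct ht hz).2.2.1.differentiableAt
    exact hasDerivAt_leaf_plane_horiz hw b y₀ (G := cF) (by simpa [hY] using hcd)
  have hgsep : ∀ {t}, t ∈ Ioo (-ρ) ρ → ∀ {z}, z ∈ Ioo ((y₀ 2) - ρ) ((y₀ 2) + ρ) →
      wb t z * fderiv ℝ cF (w (Y t z), z) (1, 0) = d z * (wb t (y₀ 2) * fderiv ℝ cF (w (Y t (y₀ 2)), (y₀ 2)) (1, 0)) := by
    intro t ht z hz
    have hev : (fun t' => cF (w (Y t' z), z)) =ᶠ[𝓝 t] fun t' => d z * cF (w (Y t' (y₀ 2)), (y₀ 2)) := by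
      filter_upwards [isOpen_Ioo.mem_nhds ht] with t' ht' using hcsep ht' hz
    exact (hct ht hz).unique (((hct ht hz0J).const_mul (d z)).congr_of_eventuallyEq hev)
  -- (7) the two expressions for `Hz` and its `z`-derivative
  set d₁ : ℝ → ℝ := deriv d with hd₁
  set d₂ : ℝ → ℝ := deriv d₁ with hd₂
  have hd₁val : ∀ {z}, z ∈ Ioo ((y₀ 2) - ρ) ((y₀ 2) + ρ) → d₁ z = ηF (w (Y 0 z), z) * d z := fun hz => (hdderiv hz).deriv
  have hHz_alt : ∀ {t}, t ∈ Ioo (-ρ) ρ → ∀ {z}, z ∈ Ioo ((y₀ 2) - ρ) ((y₀ 2) + ρ) →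
      Hz t z = Pwf (w (Y t z), z) * wb t z - d₁ z * θ t := by
    intro t ht z hz
    rw [hd₁val hz]
    have hq := hQudθ ht hz
    have hη := hηc ht hz
    have h0 := hL0' ht hz; have h1 := hL1' ht hz
    have h1' : (1 : ℝ) - L t z ≠ 0 := sub_ne_zero.mpr (Ne.symm h1)
    -- `d₁ θ = η(p(0,z)) d z θ t = η(p(t,z)) Qu t z`
    have e1 : ηF (w (Y 0 z), z) * d z * θ t = ηF (w (Y t z), z) * Qu t z := by rw [hη, hq]; ring
    calc Hz t z = ξF (w (Y t z), z) * Hf t z := rfl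
      _ = Pwf (w (Y t z), z) * wb t z - ηF (w (Y t z), z) * Qu t z := by
          simp only [hξF, hηF, hPwf, hHf, hQu, hLdef] at h0 h1' ⊢
          field_simp
          ring
      _ = Pwf (w (Y t z), z) * wb t z - ηF (w (Y 0 z), z) * d z * θ t := by rw [e1]
  -- analyticity of `d` and the derivative chain
  have hQu0an : ∀ {z}, z ∈ Ioo ((y₀ 2) - ρ) ((y₀ 2) + ρ) → AnalyticAt ℝ (Qu 0) z := by
    intro z hz
    have hm := hmemI h0I hz
    have hΛan := analyticAt_leaf_vline hwA (G := Λ) (y₀ + (0 : ℝ) • (EuclideanSpace.single b (1 : ℝ))) (z := z)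
      (by rw [foot_apply_two y₀ hb]; have := hΛA _ hm; rwa [hY2] at this)
    have hwban := analyticAt_partial_vline hwA (y₀ + (0 : ℝ) • (EuclideanSpace.single b (1 : ℝ))) (EuclideanSpace.single b (1 : ℝ)) z
    have e1 : (fun z' : ℝ => Λ (w (y₀ + (0 : ℝ) • (EuclideanSpace.single b (1 : ℝ)) + (z' - (y₀ + (0 : ℝ) • (EuclideanSpace.single b (1 : ℝ))) 2) • EuclideanSpace.single (2 : Fin 3) (1 : ℝ)), z')) =
        fun z' => L 0 z' := by funext z'; simp only [hLdef, hY, foot_apply_two y₀ hb]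
    have e2 : (fun z' : ℝ => fderiv ℝ w (y₀ + (0 : ℝ) • (EuclideanSpace.single b (1 : ℝ)) + (z' - (y₀ + (0 : ℝ) • (EuclideanSpace.single b (1 : ℝ))) 2) • EuclideanSpace.single (2 : Fin 3) (1 : ℝ)) (EuclideanSpace.single b (1 : ℝ))) =
        fun z' => wb 0 z' := by funext z'; simp only [hwb, hY, foot_apply_two y₀ hb]
    rw [e1] at hΛan; rw [e2] at hwban
    exact hΛan.mul hwban
  have hdan : ∀ {z}, z ∈ Ioo ((y₀ 2) - ρ) ((y₀ 2) + ρ) → AnalyticAt ℝ d z := fun hz => (hQu0an hz).div analyticAt_const (hQu0 h0I hz0J)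
  have hd₁an : ∀ {z}, z ∈ Ioo ((y₀ 2) - ρ) ((y₀ 2) + ρ) → AnalyticAt ℝ d₁ z := fun hz => (hdan hz).deriv
  have hd₂an : ∀ {z}, z ∈ Ioo ((y₀ 2) - ρ) ((y₀ 2) + ρ) → AnalyticAt ℝ d₂ z := fun hz => (hd₁an hz).deriv
  set d₃ : ℝ → ℝ := deriv d₂ with hd₃
  set d₄ : ℝ → ℝ := deriv d₃ with hd₄
  have hd₃an : ∀ {z}, z ∈ Ioo ((y₀ 2) - ρ) ((y₀ 2) + ρ) → AnalyticAt ℝ d₃ z := fun hz => (hd₂an hz).deriv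
  have hdD : ∀ {z}, z ∈ Ioo ((y₀ 2) - ρ) ((y₀ 2) + ρ) → HasDerivAt d (d₁ z) z := fun hz => (hdan hz).differentiableAt.hasDerivAt
  have hd₁D : ∀ {z}, z ∈ Ioo ((y₀ 2) - ρ) ((y₀ 2) + ρ) → HasDerivAt d₁ (d₂ z) z := fun hz => (hd₁an hz).differentiableAt.hasDerivAt
  have hd₂D : ∀ {z}, z ∈ Ioo ((y₀ 2) - ρ) ((y₀ 2) + ρ) → HasDerivAt d₂ (d₃ z) z := fun hz => (hd₂an hz).differentiableAt.hasDerivAt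
  have hd₃D : ∀ {z}, z ∈ Ioo ((y₀ 2) - ρ) ((y₀ 2) + ρ) → HasDerivAt d₃ (d₄ z) z := fun hz => (hd₃an hz).differentiableAt.hasDerivAt
  -- analyticity of `ε` and its chain
  have hεan : ∀ {z}, z ∈ Ioo ((y₀ 2) - ρ) ((y₀ 2) + ρ) → AnalyticAt ℝ ε z := by
    intro z hz
    have han := analyticAt_leaf_vline hwA (G := ξF) (y₀ + (0 : ℝ) • (EuclideanSpace.single b (1 : ℝ))) (z := z)
      (by rw [foot_apply_two y₀ hb]; exact (hstruct h0I hz).2.1)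
    have e : (fun z' : ℝ => ξF (w (y₀ + (0 : ℝ) • (EuclideanSpace.single b (1 : ℝ)) + (z' - (y₀ + (0 : ℝ) • (EuclideanSpace.single b (1 : ℝ))) 2) • EuclideanSpace.single (2 : Fin 3) (1 : ℝ)), z')) = ε := by
      funext z'; simp only [hε, hY, foot_apply_two y₀ hb]
    rw [e] at han; exact han
  set ε₁ : ℝ → ℝ := deriv ε with hε₁
  set ε₂ : ℝ → ℝ := deriv ε₁ with hε₂
  set ε₃ : ℝ → ℝ := deriv ε₂ with hε₃
  have hε₁an : ∀ {z}, z ∈ Ioo ((y₀ 2) - ρ) ((y₀ 2) + ρ) → AnalyticAt ℝ ε₁ z := fun hz => (hεan hz).deriv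
  have hε₂an : ∀ {z}, z ∈ Ioo ((y₀ 2) - ρ) ((y₀ 2) + ρ) → AnalyticAt ℝ ε₂ z := fun hz => (hε₁an hz).deriv
  have hεD : ∀ {z}, z ∈ Ioo ((y₀ 2) - ρ) ((y₀ 2) + ρ) → HasDerivAt ε (ε₁ z) z := fun hz => (hεan hz).differentiableAt.hasDerivAt
  have hε₁D : ∀ {z}, z ∈ Ioo ((y₀ 2) - ρ) ((y₀ 2) + ρ) → HasDerivAt ε₁ (ε₂ z) z := fun hz => (hε₁an hz).differentiableAt.hasDerivAt
  have hε₂D : ∀ {z}, z ∈ Ioo ((y₀ 2) - ρ) ((y₀ 2) + ρ) → HasDerivAt ε₂ (ε₃ z) z := fun hz => (hε₂an hz).differentiableAt.hasDerivAt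
  -- (8) the `z`-derivative of `Hz`
  set M₁ : ℝ → ℝ := fun t => -(wb t (y₀ 2) * fderiv ℝ cF (w (Y t (y₀ 2)), (y₀ 2)) (1, 0)) with hM₁
  set Hzz : ℝ → ℝ → ℝ := fun t z => -(d z * M₁ t + d₂ z * θ t) with hHzz
  have hHzD : ∀ {t}, t ∈ Ioo (-ρ) ρ → ∀ {z}, z ∈ Ioo ((y₀ 2) - ρ) ((y₀ 2) + ρ) → HasDerivAt (Hz t) (Hzz t z) z := by
    intro t ht z hz
    have hm := hmemI ht hz
    -- derivative of the alternative form
    have hPwd : DifferentiableAt ℝ Pwf (w (Y t z), z) := (hstruct ht hz).2.2.2.differentiableAt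
    have hA : HasDerivAt (fun z' => Pwf (w (Y t z'), z')) (fderiv ℝ Pwf (w (Y t z), z) (P (w (Y t z), z), 1)) z := by
      have h := hasDerivAt_leaf_plane_vert (y₀ := y₀) (G := Pwf) (t := t) (z := z) hw hb hP hm (by simpa [hY2] using hPwd)
      simpa [hY, hY2] using h
    have hB : HasDerivAt (wb t) (Pwf (w (Y t z), z) * wb t z) z := by
      have h := hasDerivAt_wb_z (y₀ := y₀) (t := t) (z := z) hU hw hb hPd hP hm
      simpa [hwb, hPwf, hY, hY2] using h
    have hC : HasDerivAt (fun z' => d₁ z' * θ t) (d₂ z * θ t) z := (hd₁D hz).mul_const (θ t)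
    have hABC := (hA.mul hB).sub hC
    have hev : Hz t =ᶠ[𝓝 z] fun z' => Pwf (w (Y t z'), z') * wb t z' - d₁ z' * θ t := by
      filter_upwards [isOpen_Ioo.mem_nhds hz] with z' hz' using hHz_alt ht hz'
    have hfin : HasDerivAt (Hz t)
        (fderiv ℝ Pwf (w (Y t z), z) (P (w (Y t z), z), 1) * wb t z + Pwf (w (Y t z), z) * (Pwf (w (Y t z), z) * wb t z) - d₂ z * θ t) z :=
      hABC.congr_of_eventuallyEq hev
    refine hfin.congr_deriv ?_
    -- identify `(Ṗw + Pw²)·wb` with `wb·c_w = d z·(wb·c_w)(t,(y₀ 2)) = −d z·M₁ t`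
    have hPc := hP2 _ hm; rw [hY2] at hPc
    have hcw : fderiv ℝ cF (w (Y t z), z) ((1 : ℝ), (0 : ℝ)) =
        fderiv ℝ P (w (Y t z), z) ((1 : ℝ), (0 : ℝ)) * fderiv ℝ P (w (Y t z), z) ((1 : ℝ), (0 : ℝ)) +
          (P (w (Y t z), z) * fderiv ℝ Pwf (w (Y t z), z) ((1 : ℝ), (0 : ℝ)) +
            fderiv ℝ (fun q => fderiv ℝ P q ((0 : ℝ), (1 : ℝ))) (w (Y t z), z) ((1 : ℝ), (0 : ℝ))) := by
      -- `cF = P·Pwf + Pzf`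
      have ec : cF = fun q => P q * Pwf q + 1 * fderiv ℝ P q ((0 : ℝ), (1 : ℝ)) := by
        funext q; simp only [hcF, hPwf]; rw [fderiv_pair_eq]
      have hPdq : DifferentiableAt ℝ P (w (Y t z), z) := hPc.differentiableAt (by norm_num)
      have hPzd : DifferentiableAt ℝ (fun q => fderiv ℝ P q ((0 : ℝ), (1 : ℝ))) (w (Y t z), z) := differentiableAt_zPartial hPc
      have hprod : DifferentiableAt ℝ (fun q => P q * Pwf q) (w (Y t z), z) := hPdq.mul hPwd
      have hz1 : DifferentiableAt ℝ (fun q => 1 * fderiv ℝ P q ((0 : ℝ), (1 : ℝ))) (w (Y t z), z) := hPzd.const_mul 1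
      rw [ec, fderiv_fun_add hprod hz1, fderiv_fun_mul hPdq hPwd, fderiv_const_mul hPzd]
      simp only [add_apply, FunLike.coe_smul, Pi.smul_apply, smul_eq_mul, hPwf]
      ring
    have hswap : fderiv ℝ (fun q => fderiv ℝ P q ((0 : ℝ), (1 : ℝ))) (w (Y t z), z) ((1 : ℝ), (0 : ℝ)) =
        fderiv ℝ Pwf (w (Y t z), z) ((0 : ℝ), (1 : ℝ)) := by simp only [hPwf]; exact fderiv_partial_swap hPc
    have hdir : fderiv ℝ Pwf (w (Y t z), z) (P (w (Y t z), z), 1) =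
        P (w (Y t z), z) * fderiv ℝ Pwf (w (Y t z), z) ((1 : ℝ), (0 : ℝ)) + 1 * fderiv ℝ Pwf (w (Y t z), z) ((0 : ℝ), (1 : ℝ)) :=
      fderiv_pair_eq _ _ _ _
    have hg := hgsep ht hz
    rw [hcw, hswap] at hg
    simp only [hHzz, hM₁]
    have hgz0 := hgsep ht hz0J
    -- express everything
    have key : (fderiv ℝ Pwf (w (Y t z), z) (P (w (Y t z), z), 1) + Pwf (w (Y t z), z) * Pwf (w (Y t z), z)) * wb t z =
        d z * (wb t (y₀ 2) * fderiv ℝ cF (w (Y t (y₀ 2)), (y₀ 2)) (1, 0)) := by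
      rw [← hg, hdir]; simp only [hPwf]; ring
    linear_combination key
  -- (9) assemble the hypotheses of `stuartBranch_false`
  have hI : (-ρ : ℝ) < ρ := by linarith
  have hJ : (y₀ 2) - ρ < (y₀ 2) + ρ := by linarith
  exact stuartBranch_false (Θ := Θ) (θ := θ) (M₁ := M₁) (d := d) (d₁ := d₁) (d₂ := d₂) (d₃ := d₃) (d₄ := d₄)
    (ε := ε) (ε₁ := ε₁) (ε₂ := ε₂) (ε₃ := ε₃) (H := Hf) (Hz := Hz) (Hzz := Hzz) hI hJ
    (fun u hu => hΘ' hu) (fun u hu => hθ0 hu)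
    (fun z hz => hdD hz) (fun z hz => hd₁D hz) (fun z hz => hd₂D hz) (fun z hz => hd₃D hz) (fun z hz => hd0 hz)
    (fun z hz => hεD hz) (fun z hz => hε₁D hz) (fun z hz => hε₂D hz)
    (fun u hu z hz => hHf0 hu hz) (fun u hu z hz => hHfz hu hz) (fun u hu z hz => hHzD hu hz)
    (fun u hu z hz => by simp only [hHz]; rw [hξaff hu hz])
    (fun u hu z hz => by simp only [hHzz])

end Main

end Summit.NavierStokesRegularity.NavierStokesRegularity.Theorems.PoloidalWindowDoorPoloidalWindowRigidityUntwistedStuartTranslation3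

end
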